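import Summits.Ventures.YMGap.RobustBall.MassGapOnBallZdGMassive
import Summits.Ventures.YMGap.RobustBall.MassGapOnBallZdGRows
import HarnessLib

/-!
# Venture YMGap, track ROBUST-BALL — the ROBUST VERTEX-STAR ROWS ON `ℤ⁴` read in the massive currency: every DLR
# state of every member of the gauge-invariant tier-1 ball is MASSIVE up to `β_W = 1/3`

HONEST FRAMING. WHAT THIS IS: a venture file (cell `pub-ymgap`, track Y2 ROBUST-BALL, seat ds-3): composition of
ds-2's robust vertex-star rows on `ℤ^d` (`MassGapOnBallZdGRows.lean`: for every
member `(W, supp)` of the gauge-invariant tier-1 ball `MemBallZdG ε₀ ε₁ R`, unique DLR state + Shen–Zhu–Zhu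
clustering, HYPOTHESIS-FREE) with the seat's conversion `massive_onBallZdG` (`MassGapOnBallZdGMassive.lean`): the
member has DLR states and EVERY DLR state is an Osterwalder–Seiler MASSIVE STATE (`IsMassiveState`: exponential
clustering of all bounded measurable local observables) with exponentially decaying plaquette–plaquette correlation
function. CELLS `SU(2)`, `d = 4` (Wilson `β_W`, one-parameter ball `(2ε, ε)`): `(1/8, .148)`, `(1/6, .112)`,
`(1/5, .087)`, `(1/4, .055)`, `(3/10, .028)`, `(1/3, .012)` and the UP-TO form on `(3/125, 3/250)` for all
`0 ≤ β_W ≤ 1/3` — the `ℤ⁴` massive rows thereby move from `β_W ≤ 1/5` (quarter door, `RowsSU2Quarter`) to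
`β_W = 1/3` (the `SU(3)` and `d = 3` star rows of `MassGapOnBallZdGRowsSUN.lean` are read the same way in a
companion file). WHAT IT IS NOT: no new number (cells and certificates
are ds-2's); strong-coupling lattice statements; nothing about the continuum limit or the Clay Millennium problem.

References: ds-2 `RobustStarDoorZd.lean`, `MassGapOnBallZdGRows.lean`; ds-3
`MassGapOnBallZdGMassive.lean`; K. Osterwalder, E. Seiler, Ann. Phys. 110 (1978) 440, §4.
-/

noncomputable section

open MeasureTheory ProbabilityTheory Function Finset Filter Topology
open scoped NNReal
open Literature.Probability.LatticeModels
open Literature.MathematicalPhysics.QuantumLattice hiding torusNorm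
open Literature.MathematicalPhysics.QuantumFieldTheory hiding ZdEdge Site
open Literature.Barriers.QuantumFields (IsMassiveState)

namespace Summit.Ventures.YMGap.RobustBall

variable {N : ℕ}

/-! ### `SU(2)`, `d = 4`: the star cells as massive rows -/

section SU2

variable {W : Potential (ZdEdge 4) (SUN 2)} {supp : Finset (ZdEdge 4) → Finset (Finset (ZdEdge 4))}

/-- ★ **`SU(2)`, `ℤ⁴`, `β_W = 1/8`, HYPOTHESIS-FREE: every member of `MemBallZdG 0.296 0.148 R` is a MASSIVE theory**
— DLR states exist and every DLR state is an Osterwalder–Seiler massive state with plaquette–plaquette decay (ds-2's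
star row `su2_massGapOnBallZdG_star_oneEighth`, 't Hooft coupling `1/32`). [folklore] -/
theorem su2_massive_star_oneEighth {R : ℕ} (hmem : MemBallZdG (37 / 125) (37 / 250) R W supp) :
    (perturbedGibbsMeasures (d := 4) (fundamentalRep (Fin 2)) (((2 : ℕ) : ℝ) * (1 / 32)) W supp).Nonempty ∧
      ∀ μ ∈ perturbedGibbsMeasures (d := 4) (fundamentalRep (Fin 2)) (((2 : ℕ) : ℝ) * (1 / 32)) W supp,
        IsMassiveState μ ∧ HasExponentialDecay (plaquetteCorrFn (fundamentalRep (Fin 2)) μ) :=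
  massive_onBallZdG (by norm_num) (su2_massGapOnBallZdG_star_oneEighth R) hmem

/-- **`SU(2)`, `ℤ⁴`, `β_W = 1/6`**: every member of `MemBallZdG 0.224 0.112 R` is a massive theory (star row
`su2_massGapOnBallZdG_star_oneSixth`, 't Hooft `1/24`). [folklore] -/
theorem su2_massive_star_oneSixth {R : ℕ} (hmem : MemBallZdG (28 / 125) (14 / 125) R W supp) :
    (perturbedGibbsMeasures (d := 4) (fundamentalRep (Fin 2)) (((2 : ℕ) : ℝ) * (1 / 24)) W supp).Nonempty ∧
      ∀ μ ∈ perturbedGibbsMeasures (d := 4) (fundamentalRep (Fin 2)) (((2 : ℕ) : ℝ) * (1 / 24)) W supp,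
        IsMassiveState μ ∧ HasExponentialDecay (plaquetteCorrFn (fundamentalRep (Fin 2)) μ) :=
  massive_onBallZdG (by norm_num) (su2_massGapOnBallZdG_star_oneSixth R) hmem

/-- **`SU(2)`, `ℤ⁴`, `β_W = 1/5`**: every member of `MemBallZdG 0.174 0.087 R` is a massive theory (star row
`su2_massGapOnBallZdG_star_oneFifth`, 't Hooft `1/20`). [folklore] -/
theorem su2_massive_star_oneFifth {R : ℕ} (hmem : MemBallZdG (87 / 500) (87 / 1000) R W supp) :
    (perturbedGibbsMeasures (d := 4) (fundamentalRep (Fin 2)) (((2 : ℕ) : ℝ) * (1 / 20)) W supp).Nonempty ∧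
      ∀ μ ∈ perturbedGibbsMeasures (d := 4) (fundamentalRep (Fin 2)) (((2 : ℕ) : ℝ) * (1 / 20)) W supp,
        IsMassiveState μ ∧ HasExponentialDecay (plaquetteCorrFn (fundamentalRep (Fin 2)) μ) :=
  massive_onBallZdG (by norm_num) (su2_massGapOnBallZdG_star_oneFifth R) hmem

/-- ★ **`SU(2)`, `ℤ⁴`, `β_W = 1/4`**: every member of `MemBallZdG 0.11 0.055 R` is a massive theory (star row
`su2_massGapOnBallZdG_star_oneQuarter`, 't Hooft `1/16`) — beyond the single-link / pair doors' reach. [folklore] -/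
theorem su2_massive_star_oneQuarter {R : ℕ} (hmem : MemBallZdG (11 / 100) (11 / 200) R W supp) :
    (perturbedGibbsMeasures (d := 4) (fundamentalRep (Fin 2)) (((2 : ℕ) : ℝ) * (1 / 16)) W supp).Nonempty ∧
      ∀ μ ∈ perturbedGibbsMeasures (d := 4) (fundamentalRep (Fin 2)) (((2 : ℕ) : ℝ) * (1 / 16)) W supp,
        IsMassiveState μ ∧ HasExponentialDecay (plaquetteCorrFn (fundamentalRep (Fin 2)) μ) :=
  massive_onBallZdG (by norm_num) (su2_massGapOnBallZdG_star_oneQuarter R) hmem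

/-- **`SU(2)`, `ℤ⁴`, `β_W = 3/10`**: every member of `MemBallZdG 0.056 0.028 R` is a massive theory (star row
`su2_massGapOnBallZdG_star_threeTenths`, 't Hooft `3/40`). [folklore] -/
theorem su2_massive_star_threeTenths {R : ℕ} (hmem : MemBallZdG (7 / 125) (7 / 250) R W supp) :
    (perturbedGibbsMeasures (d := 4) (fundamentalRep (Fin 2)) (((2 : ℕ) : ℝ) * (3 / 40)) W supp).Nonempty ∧
      ∀ μ ∈ perturbedGibbsMeasures (d := 4) (fundamentalRep (Fin 2)) (((2 : ℕ) : ℝ) * (3 / 40)) W supp,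
        IsMassiveState μ ∧ HasExponentialDecay (plaquetteCorrFn (fundamentalRep (Fin 2)) μ) :=
  massive_onBallZdG (by norm_num) (su2_massGapOnBallZdG_star_threeTenths R) hmem

/-- ★★ **`SU(2)`, `ℤ⁴`, `β_W = 1/3`, HYPOTHESIS-FREE: every member of `MemBallZdG 0.024 0.012 R` is a MASSIVE
theory** — the top of the certified star window on `ℤ⁴` (star row `su2_massGapOnBallZdG_star_oneThird`, 't Hooft
`1/12`). [folklore] -/
theorem su2_massive_star_oneThird {R : ℕ} (hmem : MemBallZdG (3 / 125) (3 / 250) R W supp) :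
    (perturbedGibbsMeasures (d := 4) (fundamentalRep (Fin 2)) (((2 : ℕ) : ℝ) * (1 / 12)) W supp).Nonempty ∧
      ∀ μ ∈ perturbedGibbsMeasures (d := 4) (fundamentalRep (Fin 2)) (((2 : ℕ) : ℝ) * (1 / 12)) W supp,
        IsMassiveState μ ∧ HasExponentialDecay (plaquetteCorrFn (fundamentalRep (Fin 2)) μ) :=
  massive_onBallZdG (by norm_num) (su2_massGapOnBallZdG_star_oneThird R) hmem

/-- ★ **`SU(2)`, `ℤ⁴`, EVERY `0 ≤ β_W ≤ 1/3` on the ball `MemBallZdG 0.024 0.012 R`**: every member is a massive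
theory at every Wilson coupling of the window (ds-2's `su2_massGapOnBallZdG_star_upTo_oneThird`; 't Hooft slot
`β_W/4`, tree coupling `β_W/2`). [folklore] -/
theorem su2_massive_star_upTo_oneThird {βW : ℝ} (h0 : 0 ≤ βW) (h : βW ≤ 1 / 3) {R : ℕ}
    (hmem : MemBallZdG (3 / 125) (3 / 250) R W supp) :
    (perturbedGibbsMeasures (d := 4) (fundamentalRep (Fin 2)) (((2 : ℕ) : ℝ) * (βW / 4)) W supp).Nonempty ∧
      ∀ μ ∈ perturbedGibbsMeasures (d := 4) (fundamentalRep (Fin 2)) (((2 : ℕ) : ℝ) * (βW / 4)) W supp,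
        IsMassiveState μ ∧ HasExponentialDecay (plaquetteCorrFn (fundamentalRep (Fin 2)) μ) :=
  massive_onBallZdG (by norm_num) (su2_massGapOnBallZdG_star_upTo_oneThird h0 h R) hmem

end SU2

end Summit.Ventures.YMGap.RobustBall

end
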